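import Mathlib
import HarnessLib
import Summits.HubbardSuperconductivity.HubbardSuperconductivity.Theorems.KLProgrammeKLRegimeEngineV8TwoLegSpaceMomentsExport

/-!
# Route `KLProgramme` — crux K3 ENGINE (stmt-HubbardSuperconductivity-20437 `KLRegimeEngineV17F2`), stub (C) (C2) / (X) export #17: the «(C2)-Z-LAW» amendment AS A
# NAMES-ONLY LAYER over the landed `…EngineV8TwoLegSpaceMomentsExport` (p618321) — registrant PRESTAGE for the pen's fold «A24∪A25∪Z(∪α1)» (plan g24 (R275)(B):
# p2 g23's prestage «A-(C2)-Z-LAW» 3d0b31745da829e0 adds ONE product-law conjunct to `IsSpaceMomPkg5`); cell gate-hubbard-kl, seat gate-hubbard-kl-p1b g16 (file owner, 20437 v2 registrant)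

WHY A LAYER AND NOT AN EDIT.  p2's prestage is a delta ON the landed module (the predicate `IsSpaceMomPkg5` gains the parameter `R` and a third conjunct, the deferred package's
`dite` condition and every `hex` binder change arity).  That module is imported by the FROZEN D3″ (`…DefsU12b`), by D3G (`…DefsU12bG`) and by `…GridLiteralsPkg`; an in-place
re-definition is a def edit of landed text (review lane, tree-wide rebuild, no inline rehearsal possible since every import chain drags the original).  The cell's standing
device for exactly this situation is the names-only SUCCESSOR LAYER (Export5→6→7→8, DefsG10→…→G14, U10→U12→U12b): new names, zero edits, the image re-keyed by hunks.
This file is that layer for #17 — p2's text VERBATIM under `…Z` names: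
* **`IsSpaceMomPkg5Z R e := IsSpaceMomPkg5 e ∧ ∀ Q cc, (1 + Σ_{j<5} R.Gfr j)·(Σ_{j<6} e.1 j)·e.2 Q cc ≤ 1/2^70`** (p2's three conjuncts; `.1` = the landed admissibility),
  `isSpaceMomPkg5Z_zero`, `IsSpaceMomPkg5Z.toPkg5`;
* the deferred package **`klSpaceMomPkg5Z P R Q₀ G`** over `∃ e, IsSpaceMomPkg5Z R e ∧ TwoLegSpaceMomentsStep5 P R Q₀ G e.1 e.2` (the STEP predicate is UNCHANGED — p2's
  string (ii)–(iv) untouched), projections **`klZsp5Z / klZspU5Z / klZsp5AtZ`** (`_apply`, `two_mul_`, `_nonneg`, `klZspU5Z_pos`), **`klZsp5Z_sum_mul_klZspU5Z_le`** = p2's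
  consumer row (4) «THE PRODUCT LAW OF THE DEFERRED PACKAGE», `twoLegSpaceMomentsStep5_klSpaceMomPkg5Z`, the unroll closer **`twoLegDualSpaceMomentsUpToAt_all_of_existsZ`**
  and **`sep_jets_klZsp5AtZ_of_exists`** (binder lists = the landed ones with `IsSpaceMomPkg5 e ↦ IsSpaceMomPkg5Z R e`, `klZsp5At ↦ klZsp5AtZ`, `klZspU5 ↦ klZspU5Z`).
IMAGE HUNKS under the layer (vs the rev 15-A24-G14 base): (X) conjunct 3 `IsSpaceMomPkg5 e ↦ IsSpaceMomPkg5Z R e` (p2's ONE declared string), (C)'s last binder and §C's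
`hm5I/hm5V` carrier `klZsp5At ↦ klZsp5AtZ`, §C's unroll `…_all_of_exists ↦ …_all_of_existsZ`, token #14's entry `klZspU5 ↦ klZspU5Z` (one more `min` entry in the «A24∪A25» U-table,
row `…_le_klZspU5Z`).  NOT A MOTION: nothing registers, no landed text is touched; the fold is the pen's (R275)(B) with its three conditions.  Definitions with bodies + the
landed module's rows re-keyed; the producer statement is a HYPOTHESIS slot; nothing about the model is asserted; nothing asserts (C), #17, any stub of 20437, K3 or superconductivity.
-/

noncomputable section

namespace Summit.HubbardSuperconductivity.HubbardSuperconductivity.Theorems.EngineV8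

set_option linter.dupNamespace false -- summit = problem name (single-conjunct summit), D-0017

open Real Finset Literature.MathematicalPhysics.QuantumLattice Literature.Probability.LatticeModels
open Literature.MathematicalPhysics.QuantumLattice.FermiRG
open Summit.HubbardSuperconductivity.HubbardSuperconductivity.Theorems.KLRegimeSplit
open Summit.HubbardSuperconductivity.HubbardSuperconductivity.Theorems.KLProgrammeLegKernels
open Summit.HubbardSuperconductivity.HubbardSuperconductivity.Theorems.DispersionFlow
open Summit.HubbardSuperconductivity.HubbardSuperconductivity.Theorems.TwoLegFourier

section PackageZ

/-- **Package admissibility with the «(C2)-Z-LAW» product law** (p2 g23's amended `IsSpaceMomPkg5 R e`, as a successor predicate): the landed admissibility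
(nonnegative budget table, positive threshold) AND `∀ Q cc, (1 + Σ_{j<5} R.Gfr j)·(Σ_{j<6} e.1 j)·e.2 Q cc ≤ 2⁻⁷⁰`. -/
def IsSpaceMomPkg5Z (R : RenConsts) (e : (ℕ → ℝ) × (EngConsts → ℝ → ℝ)) : Prop :=
  IsSpaceMomPkg5 e ∧ ∀ (Q : EngConsts) (cc : ℝ), (1 + ∑ j ∈ range 5, R.Gfr j) * (∑ j ∈ range 6, e.1 j) * e.2 Q cc ≤ 1 / 2 ^ 70

/-- A Z-admissible package is admissible in the landed sense. -/
theorem IsSpaceMomPkg5Z.toPkg5 {R : RenConsts} {e : (ℕ → ℝ) × (EngConsts → ℝ → ℝ)} (h : IsSpaceMomPkg5Z R e) : IsSpaceMomPkg5 e := h.1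

/-- The zero table with threshold `1` is Z-admissible (the product law holds with `0 ≤ 2⁻⁷⁰`). -/
theorem isSpaceMomPkg5Z_zero (R : RenConsts) : IsSpaceMomPkg5Z R (fun _ => 0, fun _ _ => 1) :=
  ⟨isSpaceMomPkg5_zero, fun _ _ => by simp⟩

/-- A Z-witness of the (X) conjunct is a witness of the landed (X) conjunct (the amended conjunct is STRONGER). -/
theorem exists_isSpaceMomPkg5_of_existsZ {P : SplitConsts} {R : RenConsts} {Q₀ : EngConsts} {G : GeoConsts}
    (hex : ∃ e : (ℕ → ℝ) × (EngConsts → ℝ → ℝ), IsSpaceMomPkg5Z R e ∧ TwoLegSpaceMomentsStep5 P R Q₀ G e.1 e.2) :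
    ∃ e : (ℕ → ℝ) × (EngConsts → ℝ → ℝ), IsSpaceMomPkg5 e ∧ TwoLegSpaceMomentsStep5 P R Q₀ G e.1 e.2 := by
  obtain ⟨e, he, hs⟩ := hex
  exact ⟨e, he.1, hs⟩

variable (P : SplitConsts) (R : RenConsts) (Q₀ : EngConsts) (G : GeoConsts)

open Classical in
/-- **The deferred package under the Z-law**: the chosen Z-admissible pair `(Z, u)` with `TwoLegSpaceMomentsStep5 P R Q₀ G Z u` if one exists, else `(0, 1)`. -/
def klSpaceMomPkg5Z : (ℕ → ℝ) × (EngConsts → ℝ → ℝ) :=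
  if h : ∃ e : (ℕ → ℝ) × (EngConsts → ℝ → ℝ), IsSpaceMomPkg5Z R e ∧ TwoLegSpaceMomentsStep5 P R Q₀ G e.1 e.2 then Classical.choose h
  else (fun _ => 0, fun _ _ => 1)

/-- **Budget table of the Z-deferred package** (n-free, per order). -/
def klZsp5Z : ℕ → ℝ := (klSpaceMomPkg5Z P R Q₀ G).1

/-- **Threshold of the Z-deferred package** (the «A24∪A25∪Z» token-#14 min-chain entry). -/
def klZspU5Z (Q : EngConsts) (cc : ℝ) : ℝ := (klSpaceMomPkg5Z P R Q₀ G).2 Q cc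

/-- **Scale-`n` budgets read by the (C) binder under the layer**: `klZsp5AtZ P R Q₀ G U n = klZspLaw (klZsp5Z P R Q₀ G) U n`. -/
def klZsp5AtZ (U : ℝ) (n : ℕ) : ℕ → ℝ := klZspLaw (klZsp5Z P R Q₀ G) U n

/-- `klZsp5AtZ` unfolded. -/
theorem klZsp5AtZ_apply (U : ℝ) (n j : ℕ) : klZsp5AtZ P R Q₀ G U n j = klZsp5Z P R Q₀ G j * U ^ 2 * ((4 : ℝ) ^ n) ^ (j - 1) := rfl

/-- `2 · klZsp5AtZ … j = (2·klZsp5Z … j) · U² · (4ⁿ)^{j−1}`. -/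
theorem two_mul_klZsp5AtZ (U : ℝ) (n j : ℕ) : 2 * klZsp5AtZ P R Q₀ G U n j = (2 * klZsp5Z P R Q₀ G j) * U ^ 2 * ((4 : ℝ) ^ n) ^ (j - 1) :=
  two_mul_klZspLaw _ U n j

/-- The Z-deferred package is Z-admissible (both branches). -/
theorem isSpaceMomPkg5Z_klSpaceMomPkg5Z : IsSpaceMomPkg5Z R (klSpaceMomPkg5Z P R Q₀ G) := by
  classical
  unfold klSpaceMomPkg5Z
  split_ifs with h
  · exact (Classical.choose_spec h).1
  · exact isSpaceMomPkg5Z_zero R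

/-- `0 ≤ klZsp5Z … j`. -/
theorem klZsp5Z_nonneg (j : ℕ) : 0 ≤ klZsp5Z P R Q₀ G j := (isSpaceMomPkg5Z_klSpaceMomPkg5Z P R Q₀ G).1.1 j

/-- `0 ≤ klZsp5AtZ … U n j`. -/
theorem klZsp5AtZ_nonneg (U : ℝ) (n j : ℕ) : 0 ≤ klZsp5AtZ P R Q₀ G U n j := klZspLaw_nonneg (klZsp5Z_nonneg P R Q₀ G) U n j

/-- **`0 < klZspU5Z …`** (the `_pos` argument of the token-#14 min-chain). -/
theorem klZspU5Z_pos (Q : EngConsts) (cc : ℝ) : 0 < klZspU5Z P R Q₀ G Q cc := (isSpaceMomPkg5Z_klSpaceMomPkg5Z P R Q₀ G).1.2 Q cc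

/-- **THE PRODUCT LAW OF THE DEFERRED PACKAGE** («(C2)-Z-LAW», p2 g23's row (4)): `(1 + Σ_{j<5} Gfr j)·(Σ_{j<6} klZsp5Z … j)·klZspU5Z … Q cc ≤ 2⁻⁷⁰` —
what the (C) closer's (C2) fits read under the U₀ booking (`U ≤ <token #14> ≤ klZspU5Z`). -/
theorem klZsp5Z_sum_mul_klZspU5Z_le (Q : EngConsts) (cc : ℝ) :
    (1 + ∑ j ∈ range 5, R.Gfr j) * (∑ j ∈ range 6, klZsp5Z P R Q₀ G j) * klZspU5Z P R Q₀ G Q cc ≤ 1 / 2 ^ 70 :=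
  (isSpaceMomPkg5Z_klSpaceMomPkg5Z P R Q₀ G).2 Q cc

variable {P R Q₀ G}

/-- In the `∃`-branch the Z-deferred package satisfies the step. -/
theorem twoLegSpaceMomentsStep5_klSpaceMomPkg5Z
    (hex : ∃ e : (ℕ → ℝ) × (EngConsts → ℝ → ℝ), IsSpaceMomPkg5Z R e ∧ TwoLegSpaceMomentsStep5 P R Q₀ G e.1 e.2) :
    TwoLegSpaceMomentsStep5 P R Q₀ G (klZsp5Z P R Q₀ G) (klZspU5Z P R Q₀ G) := by
  have e : klSpaceMomPkg5Z P R Q₀ G = Classical.choose hex := by classical unfold klSpaceMomPkg5Z; rw [dif_pos hex]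
  have h2 := (Classical.choose_spec hex).2
  unfold klZsp5Z klZspU5Z
  rw [e]; exact h2

/-- **THE UNROLL CLOSER UNDER THE LAYER**: from the amended (X) conjunct (`∃ e, IsSpaceMomPkg5Z R e ∧ TwoLegSpaceMomentsStep5 P R Q₀ G e.1 e.2`) the (C) binder
`TwoLegDualSpaceMomentsUpToAt L M (klZsp5AtZ P R Q₀ G U n) β U μ n 5` at ANY raise / volume / scale below the package threshold, given the export HISTORY `∀ j < n`. -/
theorem twoLegDualSpaceMomentsUpToAt_all_of_existsZ {Q : EngConsts} {cc μ U β : ℝ} {L M : ℕ} [NeZero L] [NeZero M] {n : ℕ}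
    (hex : ∃ e : (ℕ → ℝ) × (EngConsts → ℝ → ℝ), IsSpaceMomPkg5Z R e ∧ TwoLegSpaceMomentsStep5 P R Q₀ G e.1 e.2) (hQ : Q₀.IsRaiseOf Q)
    (hc : 0 < cc) (hc36 : cc ≤ klEngC₃6 P R) (hμ : μ ∈ klWindowC) (hU : 0 < U) (hU10 : U ≤ klEngU₀10 P R cc) (hUu : U ≤ klZspU5Z P R Q₀ G Q cc)
    (hβ : klBetaMin ≤ β) (hβc : β ≤ Real.exp (cc / U ^ 2)) (hL : klEngL₄ P R β U ≤ L) (hM : klEngM₃ β U L ≤ M) (hn : n ≤ nScales β + 1)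
    (hhist : HistP klPredsV17F2 L M G P Q R β U μ 0 n) (hfr : FrameOK R U (nScales β) μ (klFlowFrameU L M β U μ n))
    (hE : EngineBoundsAtV17F2 L M G P Q β U μ n)
    (hhistM5 : ∀ j < n, TwoLegDualSpaceMomentsUpToAt L M (klZsp5AtZ P R Q₀ G U j) β U μ j 5) :
    TwoLegDualSpaceMomentsUpToAt L M (klZsp5AtZ P R Q₀ G U n) β U μ n 5 :=
  twoLegSpaceMomentsStep5_klSpaceMomPkg5Z hex Q hQ cc hc hc36 μ hμ U hU hU10 hUu β hβ hβc L M hL hM n hn hhist hfr hE hhistM5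

/-- **THE (C2) JETS AT THE (C) SITE UNDER THE LAYER, ONE CALL** (`b j := 2 · klZsp5AtZ P R Q₀ G U n j`). -/
theorem sep_jets_klZsp5AtZ_of_exists {Q : EngConsts} {cc μ U β : ℝ} {L M : ℕ} [NeZero L] [NeZero M] {n : ℕ}
    (hex : ∃ e : (ℕ → ℝ) × (EngConsts → ℝ → ℝ), IsSpaceMomPkg5Z R e ∧ TwoLegSpaceMomentsStep5 P R Q₀ G e.1 e.2) (hQ : Q₀.IsRaiseOf Q)
    (hc : 0 < cc) (hc36 : cc ≤ klEngC₃6 P R) (hμ : μ ∈ klWindowC) (hU : 0 < U) (hU10 : U ≤ klEngU₀10 P R cc) (hUu : U ≤ klZspU5Z P R Q₀ G Q cc)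
    (hβ0 : 0 < β) (hβ : klBetaMin ≤ β) (hβc : β ≤ Real.exp (cc / U ^ 2)) (hL : klEngL₄ P R β U ≤ L) (hM : klEngM₃ β U L ≤ M)
    (hn : n ≤ nScales β + 1) (hhist : HistP klPredsV17F2 L M G P Q R β U μ 0 n) (hfr : FrameOK R U (nScales β) μ (klFlowFrameU L M β U μ n))
    (hE : EngineBoundsAtV17F2 L M G P Q β U μ n)
    (hhistM5 : ∀ j < n, TwoLegDualSpaceMomentsUpToAt L M (klZsp5AtZ P R Q₀ G U j) β U μ j 5) :
    ∀ j, 1 ≤ j → j ≤ 5 → ∀ q : Momentum,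
      ‖iteratedFDeriv ℝ j (evalM (symInterp L (fun k => klLocSelfEnergyRe L M β U μ (klFlowFrameU L M β U μ n) n k -
        (klFlowFrameU L M β U μ n).eval (latticeMomentum L k)))) q‖ ≤ 2 * klZsp5AtZ P R Q₀ G U n j :=
  sep_jets_of_twoLegDualSpaceMomentsUpToAt hβ0
    (twoLegDualSpaceMomentsUpToAt_all_of_existsZ hex hQ hc hc36 hμ hU hU10 hUu hβ hβc hL hM hn hhist hfr hE hhistM5)

end PackageZ

end Summit.HubbardSuperconductivity.HubbardSuperconductivity.Theorems.EngineV8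

end
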